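import Literature.AlgebraicGeometry.HodgeTheory.SymmetricA3ReducedChart
import Literature.AlgebraicGeometry.HodgeTheory.SymmetricA3ReducedFunctionJets
import Literature.AlgebraicGeometry.HodgeTheory.SmoothHypersurfaceAtlas
import Literature.Geometry.ComplexAnalytic.HolomorphicSplittingPowerChart
import Mathlib.Analysis.Calculus.FDeriv.CompCLM
import HarnessLib

/-!
# The `A₃` normal-form chart at a symmetric `A₃` point: `f₁(e_j + y) = Σᵢ wᵢ(y)² + u(y)⁴`

Family `hodge`, layer `Literature/AlgebraicGeometry/HodgeTheory`, sequel of `SymmetricA3ReducedChart` (S2b: the critical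
curve `xs(0, u)` of `f₁` on the slice `x_j = 1`), `SymmetricA3ReducedFunctionJets` (`ord_{u=0} f₁(xs(0,u)) = 4`),
`SymmetricA3SliceReduction` (S0: the Hessian of `f₁` at `e_j` is injective on `v_j = v_k = 0`) and of the holomorphic
splitting lemma `Literature/Geometry/ComplexAnalytic/HolomorphicSplittingPowerChart` (`exists_powChart_of_criticalCurve'`).
Written by the prover seat `hodge-nonav-prover-Bx` (g16, cell `hodge-nonav`) as brick B4a-4 of the programme «A₃-TRACE» for
the stub hN′ = `stub_a3NonCommOdd` of crux K1-B `VeryGeneralSignCommutatorsInHg` of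
`Summits/HodgeConjecture/HodgeConjecture/Theses/SignSymmetricPowers.lean` (stmt-HodgeConjecture-19716): it is the CHART INPUT
of the `A₃` localisation H-A3LOC (the weighted-pencil isotopy port, bricks `WeightedPencil*`, and the Pham–Brieskorn local
model with exponents `(2, …, 2, 4)`).

**Theorem (`IsSymmetricA3Datum.exists_A3NormalFormChart`).**  Let `f₁, g₀, g₂` be forms of degree `d` on `ℙⁿ⁺¹`, `n ≥ 1`, with
`IsSymmetricA3Datum f₁ g₀ g₂ j k a` (AGZV II §5.2: `e_j` an `A₃` point of `f₁` with kernel coordinate `x_k`).  In the affine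
chart `y ↦ e_j + insertNth j 0 y` of `ℙⁿ⁺¹` at `e_j` there is a holomorphic chart `Θ` of `ℂⁿ⁺¹` at `0` (`Θ 0 = 0`, real `C^∞`
with `C^∞` inverse) with
`Σᵢ (Θ y)ᵢ^{aᵢ} = f₁(e_j + insertNth j 0 y)`, `a = (2, …, 2, 4)` (`aᵢ = 4` iff `i = Fin.last n`):
the normal form `A₃ : u⁴ + Σ wᵢ²` (AGZV I §11.1) in coordinates adapted to the pencil.  Proof: reorder the coordinates so
that the kernel coordinate `x_k` is last; the critical curve `u ↦ xs(0, u)` of the reduced chart consists of critical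
points of the restrictions of `f₁` to `u = const` (`∂ᵢ f₁ = 0`, `i ∉ {j, k}`); the `w`-Hessian at `e_j` is non-degenerate
(`eq_zero_of_sum_hessian_mul_eq_zero`, Euler for the row `j`, the datum for the row `k`); and the restriction of `f₁` to
the critical curve has order `4` (`reduced_analyticOrderAt_eq_four`); conclude by `exists_powChart_of_criticalCurve'`.

## References
* [ArnoldGuseinzadeVarchenko2012] AGZV II, Part I §5.2 (boundary singularity `B₂`; pp. 129–133 of the held text).
* [ArnoldGuseinZadeVarchenko1985] AGZV I, §9.6 (Morse lemma with parameters), §11.1 (`A_k : x^{k+1} + Σ yᵢ²`).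
* [VoisinHodgeII2003] Voisin II, §2.1.1 Lemma 2.7, Cor. 2.8 (Hessian and Euler at a singular point).
-/

noncomputable section

open MvPolynomial Metric Set Filter
open scoped Topology ContDiff
open Literature.AlgebraicGeometry.Motives
open Literature.Geometry.ComplexAnalytic
open Literature.Geometry.ComplexAnalytic.HolomorphicSplitting

namespace Literature.AlgebraicGeometry.HodgeTheory

section HodgeTheory

variable {n d : ℕ} {f₁ g₀ g₂ : MvPolynomial (Fin (n + 2)) ℂ} {j k : Fin (n + 2)} {a : Fin (n + 2) → ℂˣ}

namespace IsSymmetricA3Datum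

open DiscriminantBranches

/-- **The `A₃` normal-form chart at a symmetric `A₃` point** (module docstring): for forms `f₁, g₀, g₂` of degree `d` on
`ℙⁿ⁺¹`, `n ≥ 1`, with `IsSymmetricA3Datum f₁ g₀ g₂ j k a`, there is an open partial homeomorphism `Θ` of
`Fin (n + 1) → ℂ` with `0 ∈ Θ.source`, `Θ 0 = 0`, complex differentiable and real `C^∞` on `Θ.source`, `Θ.symm` real
`C^∞` on `Θ.target`, and `Σᵢ (Θ y i)^{aᵢ} = f₁(e_j + insertNth j 0 y)` on `Θ.source`, where `aᵢ = 4` for `i = Fin.last n`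
and `aᵢ = 2` otherwise (normal form `A₃`, the kernel direction carried by the last model coordinate).
[cite: ArnoldGuseinzadeVarchenko2012, Part I §5.2] [cite: ArnoldGuseinZadeVarchenko1985, §9.6 and §11.1]
[cite: VoisinHodgeII2003, §2.1.1 Lemma 2.7] -/
theorem exists_A3NormalFormChart (hf₁ : f₁.IsHomogeneous d) (hg₀ : g₀.IsHomogeneous d)
    (hg₂ : g₂.IsHomogeneous d) (hn : 1 ≤ n) (hD : IsSymmetricA3Datum f₁ g₀ g₂ j k a) :
    ∃ Θ : OpenPartialHomeomorph (Fin (n + 1) → ℂ) (Fin (n + 1) → ℂ),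
      (0 : Fin (n + 1) → ℂ) ∈ Θ.source ∧ Θ 0 = 0 ∧
      DifferentiableOn ℂ Θ Θ.source ∧ ContDiffOn ℝ ∞ Θ Θ.source ∧ ContDiffOn ℝ ∞ Θ.symm Θ.target ∧
      ∀ y ∈ Θ.source, ∑ i, (Θ y i) ^ (if i = Fin.last n then 4 else 2 : ℕ) =
        eval (Pi.single j 1 + Fin.insertNth j (0 : ℂ) y) f₁ := by
  classical
  obtain ⟨m, rfl⟩ : ∃ m, n = m + 1 := ⟨n - 1, by omega⟩
  have hjk : j ≠ k := hD.1
  obtain ⟨k', hk'⟩ := Fin.exists_succAbove_eq hjk.symm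
  -- ### coordinates: `J₁ y = insertNth j 0 y` (affine chart `x_j = 1`), `J₂ z = insertNth k' (z last) (init z)`
  let J₁ : (Fin (m + 2) → ℂ) →L[ℂ] (Fin (m + 3) → ℂ) :=
    ContinuousLinearMap.pi (Fin.insertNth j (0 : (Fin (m + 2) → ℂ) →L[ℂ] ℂ)
      (fun i => ContinuousLinearMap.proj (R := ℂ) (φ := fun _ : Fin (m + 2) => ℂ) i))
  have hJ₁j : ∀ y, J₁ y j = 0 := fun y => by
    simp [J₁, Fin.insertNth_apply_same]
  have hJ₁s : ∀ y (i : Fin (m + 2)), J₁ y (j.succAbove i) = y i := fun y i => by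
    simp [J₁, Fin.insertNth_apply_succAbove]
  have hJ₁ : ∀ y, J₁ y = Fin.insertNth j (0 : ℂ) y := by
    intro y
    refine (Fin.insertNth_eq_iff.2 ⟨(hJ₁j y).symm, ?_⟩).symm
    funext i
    rw [Fin.removeNth_apply, hJ₁s]
  let J₂ : (Fin (m + 2) → ℂ) →L[ℂ] (Fin (m + 2) → ℂ) :=
    ContinuousLinearMap.pi (Fin.insertNth k'
      (ContinuousLinearMap.proj (R := ℂ) (φ := fun _ : Fin (m + 2) => ℂ) (Fin.last (m + 1)))
      (fun i : Fin (m + 1) => ContinuousLinearMap.proj (R := ℂ) (φ := fun _ : Fin (m + 2) => ℂ) i.castSucc))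
  have hJ₂k : ∀ z, J₂ z k' = z (Fin.last (m + 1)) := fun z => by
    simp [J₂, Fin.insertNth_apply_same]
  have hJ₂s : ∀ z (i : Fin (m + 1)), J₂ z (k'.succAbove i) = z i.castSucc := fun z i => by
    simp [J₂, Fin.insertNth_apply_succAbove]
  obtain ⟨J, hJdef⟩ : ∃ J : (Fin (m + 2) → ℂ) →L[ℂ] (Fin (m + 3) → ℂ), J = J₁.comp J₂ := ⟨_, rfl⟩
  have hJ : ∀ z, J z = Fin.insertNth j (0 : ℂ) (Fin.insertNth k' (z (Fin.last (m + 1))) (Fin.init z)) := by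
    intro z
    rw [hJdef, ContinuousLinearMap.comp_apply, hJ₁]
    congr 1
    funext l
    refine Fin.succAboveCases k' ?_ (fun i => ?_) l
    · rw [hJ₂k, Fin.insertNth_apply_same]
    · rw [hJ₂s, Fin.insertNth_apply_succAbove]
      rfl
  have hJj : ∀ z, J z j = 0 := fun z => by rw [hJ, Fin.insertNth_apply_same]
  have hJk : ∀ z, J z k = z (Fin.last (m + 1)) := fun z => by
    rw [hJ, ← hk', Fin.insertNth_apply_succAbove, Fin.insertNth_apply_same]
  have hJs : ∀ z (i : Fin (m + 1)), J z (j.succAbove (k'.succAbove i)) = z i.castSucc := fun z i => by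
    rw [hJ, Fin.insertNth_apply_succAbove, Fin.insertNth_apply_succAbove]
    rfl
  have hkl : ∀ i : Fin (m + 1), k ≠ j.succAbove (k'.succAbove i) := fun i => by
    rw [← hk']
    exact fun h => (Fin.succAbove_ne k' i).symm (Fin.succAbove_right_injective h)
  have hJsingle : ∀ i : Fin (m + 1), J (Pi.single i.castSucc 1) = Pi.single (j.succAbove (k'.succAbove i)) 1 := by
    intro i
    funext l
    refine Fin.succAboveCases j ?_ (fun l' => ?_) l
    · rw [hJj, Pi.single_eq_of_ne (Fin.succAbove_ne j _).symm]
    · refine Fin.succAboveCases k' ?_ (fun i' => ?_) l'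
      · rw [hk', hJk, Pi.single_eq_of_ne (Fin.castSucc_lt_last i).ne', Pi.single_eq_of_ne (hkl i)]
      · rw [hJs, Pi.single_apply, Pi.single_apply]
        simp only [Fin.castSucc_inj, Fin.succAbove_right_inj]
  have hJsnoc : ∀ (w : Fin (m + 1) → ℂ) (x : ℂ),
      J (Fin.snoc w x) = Fin.insertNth j (0 : ℂ) (Fin.insertNth k' x w) := by
    intro w x
    rw [hJ, Fin.snoc_last, Fin.init_snoc]
  -- the inverse reindexing `π y = snoc (y ∘ k'.succAbove) (y k')`, `J₂ (π y) = y`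
  let πℓ : (Fin (m + 2) → ℂ) ≃ₗ[ℂ] (Fin (m + 2) → ℂ) :=
    { toFun := fun y => Fin.snoc (fun i => y (k'.succAbove i)) (y k')
      invFun := fun z => J₂ z
      map_add' := fun y y' => by
        funext l
        refine Fin.lastCases ?_ (fun i => ?_) l
        · simp only [Fin.snoc_last, Pi.add_apply]
        · simp only [Fin.snoc_castSucc, Pi.add_apply]
      map_smul' := fun c y => by
        funext l
        refine Fin.lastCases ?_ (fun i => ?_) l
        · simp only [Fin.snoc_last, Pi.smul_apply, RingHom.id_apply]
        · simp only [Fin.snoc_castSucc, Pi.smul_apply, RingHom.id_apply]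
      left_inv := fun y => by
        funext l
        refine Fin.succAboveCases k' ?_ (fun i => ?_) l
        · simp only [hJ₂k, Fin.snoc_last]
        · simp only [hJ₂s, Fin.snoc_castSucc]
      right_inv := fun z => by
        funext l
        refine Fin.lastCases ?_ (fun i => ?_) l
        · simp only [Fin.snoc_last, hJ₂k]
        · simp only [Fin.snoc_castSucc, hJ₂s] }
  let π : (Fin (m + 2) → ℂ) ≃L[ℂ] (Fin (m + 2) → ℂ) := πℓ.toContinuousLinearEquiv
  have hJ₂π : ∀ y, J₂ (π y) = y := fun y => πℓ.left_inv y
  have hJπ : ∀ y, J (π y) = Fin.insertNth j (0 : ℂ) y := fun y => by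
    rw [hJdef, ContinuousLinearMap.comp_apply, hJ₂π, hJ₁]
  -- ### the local equation `φ z = f₁(e_j + J z)` and its first two derivatives at `0`
  have hφd' : ∀ (F : MvPolynomial (Fin (m + 3)) ℂ) (z : Fin (m + 2) → ℂ),
      HasFDerivAt (fun z => eval ((Pi.single j 1 : Fin (m + 3) → ℂ) + J z) F)
        ((evalDeriv F ((Pi.single j 1 : Fin (m + 3) → ℂ) + J z)).comp J) z := by
    intro F z
    have hg := hasFDerivAt_mvPolynomial_eval F ((Pi.single j 1 : Fin (m + 3) → ℂ) + J z)
    exact hg.comp z (J.hasFDerivAt.const_add (Pi.single j 1 : Fin (m + 3) → ℂ))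
  have hφd : DifferentiableOn ℂ (fun z => eval ((Pi.single j 1 : Fin (m + 3) → ℂ) + J z) f₁) univ :=
    fun z _ => (hφd' f₁ z).differentiableAt.differentiableWithinAt
  have hgrad0 : evalDeriv f₁ (Pi.single j (1 : ℂ) : Fin (m + 3) → ℂ) = 0 := by
    ext v
    rw [evalDeriv_apply]
    simp [hD.2.1]
  have h1 : fderiv ℂ (fun z => eval ((Pi.single j 1 : Fin (m + 3) → ℂ) + J z) f₁) 0 = 0 := by
    rw [(hφd' f₁ 0).fderiv, map_zero, add_zero, hgrad0, ContinuousLinearMap.zero_comp]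
  let E' : (Fin (m + 2) → ℂ) →L[ℂ] (Fin (m + 3) → ℂ) →L[ℂ] ℂ :=
    ∑ l, (((evalDeriv (pderiv l f₁) (Pi.single j 1 : Fin (m + 3) → ℂ)).comp J).smulRight
      (ContinuousLinearMap.proj (R := ℂ) (φ := fun _ : Fin (m + 3) => ℂ) l) :
        (Fin (m + 2) → ℂ) →L[ℂ] (Fin (m + 3) → ℂ) →L[ℂ] ℂ)
  have hE : HasFDerivAt (fun z => evalDeriv f₁ ((Pi.single j 1 : Fin (m + 3) → ℂ) + J z)) E' 0 := by
    have h1 : HasFDerivAt (fun z => ∑ l, eval ((Pi.single j 1 : Fin (m + 3) → ℂ) + J z) (pderiv l f₁) •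
        (ContinuousLinearMap.proj (R := ℂ) (φ := fun _ : Fin (m + 3) => ℂ) l)) E' 0 := by
      refine HasFDerivAt.fun_sum fun l _ => ?_
      have h2 := hφd' (pderiv l f₁) 0
      rw [map_zero, add_zero] at h2
      exact (h2.smul_const (ContinuousLinearMap.proj (R := ℂ) (φ := fun _ : Fin (m + 3) => ℂ) l) :)
    refine h1.congr_of_eventuallyEq (Eventually.of_forall fun w => ?_)
    rfl
  set L : (Fin (m + 2) → ℂ) →L[ℂ] (Fin (m + 2) → ℂ) →L[ℂ] ℂ :=
    (((ContinuousLinearMap.compL ℂ (Fin (m + 2) → ℂ) (Fin (m + 3) → ℂ) ℂ).flip J)).comp E' with hL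
  have h2 : HasFDerivAt (fderiv ℂ (fun z => eval ((Pi.single j 1 : Fin (m + 3) → ℂ) + J z) f₁)) L 0 := by
    have hfd : fderiv ℂ (fun z => eval ((Pi.single j 1 : Fin (m + 3) → ℂ) + J z) f₁) =
        fun z => (evalDeriv f₁ ((Pi.single j 1 : Fin (m + 3) → ℂ) + J z)).comp J :=
      funext fun z => (hφd' f₁ z).fderiv
    rw [hfd, hL]
    exact ((ContinuousLinearMap.compL ℂ (Fin (m + 2) → ℂ) (Fin (m + 3) → ℂ) ℂ).flip J).hasFDerivAt.comp 0 hE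
  have hLapply : ∀ u v, L u v =
      ∑ l, (∑ i, eval (Pi.single j (1 : ℂ) : Fin (m + 3) → ℂ) (pderiv i (pderiv l f₁)) * J u i) * J v l := by
    intro u v
    simp only [hL, E', ContinuousLinearMap.comp_apply, ContinuousLinearMap.flip_apply, ContinuousLinearMap.compL_apply,
      FunLike.coe_sum, Finset.sum_apply, ContinuousLinearMap.smulRight_apply, ContinuousLinearMap.proj_apply,
      FunLike.coe_smul, Pi.smul_apply, smul_eq_mul, evalDeriv_apply]
  -- ### the `w`-Hessian at `e_j` is non-degenerate (rows `j`, `k` vanish by Euler and the datum)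
  have hHcol_j : ∀ i', eval (Pi.single j (1 : ℂ) : Fin (m + 3) → ℂ) (pderiv i' (pderiv j f₁)) = 0 := fun i' => by
    have h := congr_fun (hD.hessianAt_mulVec_single_j hf₁) i'
    rw [Matrix.mulVec_single_one] at h
    simpa [hessianAt] using h
  have hHcol_k : ∀ i', eval (Pi.single j (1 : ℂ) : Fin (m + 3) → ℂ) (pderiv i' (pderiv k f₁)) = 0 := hD.2.2.2.2.1
  have hHsymm : ∀ i i', eval (Pi.single j (1 : ℂ) : Fin (m + 3) → ℂ) (pderiv i (pderiv i' f₁)) =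
      eval (Pi.single j (1 : ℂ) : Fin (m + 3) → ℂ) (pderiv i' (pderiv i f₁)) :=
    fun i i' => hessianAt_comm f₁ (Pi.single j 1) i i'
  have hLnd : ∀ u : Fin (m + 1) → ℂ, (∀ v : Fin (m + 1) → ℂ, L (Fin.snoc u 0) (Fin.snoc v 0) = 0) → u = 0 := by
    intro u hu
    obtain ⟨V, hV⟩ : ∃ V : Fin (m + 3) → ℂ, V = J (Fin.snoc u 0) := ⟨_, rfl⟩
    have hVj : V j = 0 := by rw [hV, hJj]
    have hVk : V k = 0 := by rw [hV, hJk, Fin.snoc_last]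
    have hVs : ∀ i, V (j.succAbove (k'.succAbove i)) = u i := fun i => by rw [hV, hJs, Fin.snoc_castSucc]
    have hsv : ∀ i' : Fin (m + 1), (Fin.snoc (Pi.single i' (1 : ℂ)) (0 : ℂ) : Fin (m + 2) → ℂ) =
        Pi.single i'.castSucc 1 := by
      intro i'
      funext l
      refine Fin.lastCases ?_ (fun i => ?_) l
      · rw [Fin.snoc_last, Pi.single_eq_of_ne (Fin.castSucc_lt_last i').ne']
      · rw [Fin.snoc_castSucc, Pi.single_apply, Pi.single_apply]
        simp only [Fin.castSucc_inj]
    have hcol : ∀ i' : Fin (m + 1),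
        ∑ i, eval (Pi.single j (1 : ℂ) : Fin (m + 3) → ℂ) (pderiv i (pderiv (j.succAbove (k'.succAbove i')) f₁)) *
          V i = 0 := by
      intro i'
      have h := hu (Pi.single i' 1)
      rw [hLapply, ← hV, hsv, hJsingle] at h
      simpa only [Pi.single_apply, mul_ite, mul_one, mul_zero, Finset.sum_ite_eq', Finset.mem_univ, if_true] using h
    have hrow : ∀ i, ∑ i', eval (Pi.single j (1 : ℂ) : Fin (m + 3) → ℂ) (pderiv i (pderiv i' f₁)) * V i' = 0 := by
      intro i
      refine Fin.succAboveCases j ?_ (fun l' => ?_) i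
      · exact Finset.sum_eq_zero fun i' _ => by rw [hHsymm, hHcol_j, zero_mul]
      · refine Fin.succAboveCases k' ?_ (fun i₀ => ?_) l'
        · rw [hk']
          exact Finset.sum_eq_zero fun i' _ => by rw [hHsymm, hHcol_k, zero_mul]
        · exact (Finset.sum_congr rfl fun i' _ => by rw [hHsymm]).trans (hcol i₀)
    have hV0 : V = 0 := hD.eq_zero_of_sum_hessian_mul_eq_zero hf₁ hVj hVk hrow
    funext i
    rw [← hVs i, hV0, Pi.zero_apply, Pi.zero_apply]
  -- ### the critical curve `u ↦ xs (0, u)` of the reduced chart, in `z`-coordinates `snoc (c u) u`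
  obtain ⟨D, xs, s, hDo, h0D, hxsA, hsd, hxs0, hchart, -, hks, -, hgrad, -⟩ := hD.exists_reducedChart hf₁ hg₀ hg₂
  have hord4 : analyticOrderAt (fun u : ℂ => eval (xs ((0 : ℂ × ℂ), u)) (f₁ + (0 : ℂ) • g₂ + (0 : ℂ) • g₀)) 0 = 4 :=
    reduced_analyticOrderAt_eq_four hf₁ hD hDo h0D hxsA hsd hxs0 hchart hks hgrad
      (r := fun q => eval (xs q) (f₁ + q.1.1 • g₂ + q.1.2 • g₀)) (fun q => rfl)
  have hιc : Continuous fun u : ℂ => (((0 : ℂ × ℂ), u) : (ℂ × ℂ) × ℂ) := by fun_prop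
  have hιd : Differentiable ℂ fun u : ℂ => (((0 : ℂ × ℂ), u) : (ℂ × ℂ) × ℂ) := fun u =>
    (hasFDerivAt_prodMk_right (𝕜 := ℂ) (0 : ℂ × ℂ) u).differentiableAt
  obtain ⟨r₁, hr₁, hr₁D⟩ := Metric.isOpen_iff.1 (hDo.preimage hιc) 0 (by
    show (((0 : ℂ × ℂ), (0 : ℂ)) : (ℂ × ℂ) × ℂ) ∈ D
    rw [Prod.mk_zero_zero]; exact h0D)
  have hr₁D' : ∀ u ∈ ball (0 : ℂ) r₁, (((0 : ℂ × ℂ), u) : (ℂ × ℂ) × ℂ) ∈ D := fun u hu => hr₁D hu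
  obtain ⟨c, hc⟩ : ∃ c : ℂ → (Fin (m + 1) → ℂ),
      ∀ u i, c u i = xs ((0 : ℂ × ℂ), u) (j.succAbove (k'.succAbove i)) := ⟨fun u i => _, fun u i => rfl⟩
  have hc0 : c 0 = 0 := by
    funext i
    rw [hc, Prod.mk_zero_zero, hxs0, Pi.zero_apply]
    exact Pi.single_eq_of_ne (Fin.succAbove_ne j _) _
  have hcd : DifferentiableOn ℂ c (ball 0 r₁) := by
    have hx : DifferentiableOn ℂ (fun u : ℂ => xs ((0 : ℂ × ℂ), u)) (ball 0 r₁) :=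
      hxsA.differentiableOn.comp hιd.differentiableOn fun u hu => hr₁D' u hu
    refine differentiableOn_pi.2 fun i => ?_
    have h := (differentiableOn_pi.1 hx) (j.succAbove (k'.succAbove i))
    exact h.congr fun u _ => hc u i
  have hxsJ : ∀ u ∈ ball (0 : ℂ) r₁,
      (Pi.single j 1 : Fin (m + 3) → ℂ) + J (Fin.snoc (c u) u) = xs ((0 : ℂ × ℂ), u) := by
    intro u hu
    obtain ⟨hxj, hxk, -⟩ := hchart _ (hr₁D' u hu)
    funext l
    rw [Pi.add_apply, hJsnoc]
    refine Fin.succAboveCases j ?_ (fun l' => ?_) l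
    · rw [Pi.single_eq_same, Fin.insertNth_apply_same, add_zero, hxj]
    · rw [Pi.single_eq_of_ne (Fin.succAbove_ne j l'), zero_add, Fin.insertNth_apply_succAbove]
      refine Fin.succAboveCases k' ?_ (fun i => ?_) l'
      · rw [Fin.insertNth_apply_same, hk', hxk]
      · rw [Fin.insertNth_apply_succAbove, hc]
  have hcrit : ∀ u ∈ ball (0 : ℂ) r₁, ∀ i : Fin (m + 1),
      fderiv ℂ (fun z => eval ((Pi.single j 1 : Fin (m + 3) → ℂ) + J z) f₁) (Fin.snoc (c u) u)
        (Pi.single i.castSucc 1) = 0 := by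
    intro u hu i
    obtain ⟨-, -, hpart⟩ := hchart _ (hr₁D' u hu)
    rw [(hφd' f₁ _).fderiv, ContinuousLinearMap.comp_apply, hxsJ u hu, hJsingle, evalDeriv_apply]
    simp only [Pi.single_apply, mul_ite, mul_one, mul_zero, Finset.sum_ite_eq', Finset.mem_univ, if_true]
    have h := hpart (j.succAbove (k'.succAbove i)) (Fin.succAbove_ne j _) (hkl i).symm
    simpa using h
  -- order four along the critical curve
  have hord : analyticOrderAt (fun u : ℂ => eval ((Pi.single j 1 : Fin (m + 3) → ℂ) + J (Fin.snoc (c u) u)) f₁ -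
      eval ((Pi.single j 1 : Fin (m + 3) → ℂ) + J 0) f₁) 0 = ((4 : ℕ) : ℕ∞) := by
    rw [Nat.cast_ofNat, ← hord4]
    refine analyticOrderAt_congr ?_
    filter_upwards [isOpen_ball.mem_nhds (mem_ball_self hr₁)] with u hu
    rw [hxsJ u hu, map_zero, add_zero, hD.eval_f₁ hf₁, sub_zero, zero_smul, zero_smul, add_zero, add_zero]
  -- ### the `A₃` chart in `z`-coordinates, transported to the affine coordinates `y` by `π`
  obtain ⟨Θ', h0Θ', hΘ'0, -, hΘ'd, hΘ'cd, hΘ'scd, hΘ'φ⟩ :=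
    exists_powChart_of_criticalCurve' isOpen_univ hφd (mem_univ _) hr₁ hcd hc0 (fun u _ => mem_univ _) hcrit h1 h2
      hLnd (p := 4) (by norm_num) hord
  have hsrc : (π.toHomeomorph.transOpenPartialHomeomorph Θ').source = π ⁻¹' Θ'.source := rfl
  have htgt : (π.toHomeomorph.transOpenPartialHomeomorph Θ').target = Θ'.target := rfl
  have happ : ∀ y, (π.toHomeomorph.transOpenPartialHomeomorph Θ') y = Θ' (π y) := fun y => rfl
  have hsymm : ∀ z, (π.toHomeomorph.transOpenPartialHomeomorph Θ').symm z = π.symm (Θ'.symm z) := fun z => rfl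
  refine ⟨π.toHomeomorph.transOpenPartialHomeomorph Θ', ?_, ?_, ?_, ?_, ?_, ?_⟩
  · rw [hsrc, mem_preimage, map_zero]
    exact h0Θ'
  · rw [happ, map_zero, hΘ'0]
  · rw [hsrc]
    exact (hΘ'd.comp π.differentiable.differentiableOn fun y hy => hy).congr fun y _ => happ y
  · rw [hsrc]
    exact (hΘ'cd.comp (π.contDiff.restrict_scalars ℝ).contDiffOn fun y hy => hy).congr fun y _ => happ y
  · rw [htgt]
    exact ((π.symm.contDiff.restrict_scalars ℝ).comp_contDiffOn hΘ'scd).congr fun z _ => hsymm z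
  · intro y hy
    rw [hsrc, mem_preimage] at hy
    have h := hΘ'φ (π y) hy
    rw [map_zero, add_zero, hD.eval_f₁ hf₁, sub_zero, hJπ] at h
    rw [← h]
    refine Finset.sum_congr rfl fun l _ => ?_
    rw [happ]
    congr 1
    refine Fin.lastCases ?_ (fun i => ?_) l
    · simp [Fin.snoc_last]
    · simp [Fin.snoc_castSucc, (Fin.castSucc_lt_last i).ne]

end IsSymmetricA3Datum

end HodgeTheory

end Literature.AlgebraicGeometry.HodgeTheory

end
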